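import Summits.BirchSwinnertonDyer.BirchSwinnertonDyer.Theorems.GenusKolyvaginAtTwoGenusPrimitiveSupplyAtTwoGenusCharacter

/-!
# Route `GenusKolyvaginAtTwo`, crux `GenusPrimitiveSupplyAtTwo` (stmt-BirchSwinnertonDyer-22136), line `genus-supply`:
# the PRIME-LEVEL EXACTNESS CRITERION — on `M₀ ≥ 1` the certificate `P(ℓ) ∉ 2E(K[ℓ])` is EXACTLY
# «the genus-character Heegner point `Y_χ` is `2`-divisible but not `4`-divisible in `E(K[ℓ])`»

Lead prover seat bsd-line-gk2-p1 (g3). Frame and notation of `…GenusField` / `…GenusCharacter`: `ℓ` a Kolyvagin prime at `2`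
(inert in `K`, `ℓ ∤ N_E`, `2 ∣ a_ℓ`), `θ = √ℓ* ∈ K[ℓ]`, `T⁺ = Gal(K[ℓ]/K(θ))`, `T⁻` its complement in `𝒢_ℓ = Gal(K[ℓ]/K)`,
`Y^± = Σ_{g ∈ T^±} g·y(ℓ)`, `Y_χ = Y⁺ − Y⁻` (the `χ_ℓ`-isotypic genus point = Heegner datum of the genus pair
`(E^{(ℓ*)}, E^{(d_K ℓ*)})`), `y_K′ = Σ_{s∈S} s·y₁` (`y_K = P(1)` read in `E(K[ℓ])`, `y₁ ∈ E(K[ℓ])` the point over `x(1)`).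
Landed so far (g0/g2): `P(ℓ) ∈ 2E ⟺ Y⁺ ∈ 2E` (`heegner_exists_two_zsmul_eq_derivedPoint_iff_genusTrace`) and
`2·Y⁺ = a_ℓ·y_K′ + Y_χ` (`heegner_two_zsmul_fixPart_eq`). This file adds:
* §1 `Y_χ ∈ 2E(K[ℓ])` UNCONDITIONALLY at a Kolyvagin prime at `2` (`Y_χ = 2(Y⁺ − (a_ℓ/2)·y_K′)`): the genus Heegner index
  `m_ℓ = [E^{(ℓ*)}(K) : ℤY_χ]` is always EVEN — the algebraic shadow of the Tamagawa factor `c_ℓ(E^{(ℓ*)}) ∈ {2, 4}` (CHECK 3 of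
  the cell's U-LEDGER v1, gk2-p3);
* §2 on `y_K′ ∈ 2E(K[ℓ])` — McCallum's `M₀ ≥ 1`, which BSD predicts on every cell of WALL row 1 (`16 ∣ #Ш_an(E)`) and which is the
  only case where a level `> 1` is needed at all (at `M₀ = 0` the crux is certified at `n = 1`, `…GenusReductionComposite`
  `exists_derivedPoint_not_two_dvd_of_level_one`) —: `P(ℓ) ∈ 2E(K[ℓ]) ⟺ Y_χ ∈ 4E(K[ℓ])`; hence the EXACTNESS CRITERION
  «`Y_χ = 2G` with `G ∉ 2E(K[ℓ])` ⟹ `P(ℓ) ∉ 2E(K[ℓ])`» and its converse «`Y_χ ∈ 4E` ⟹ `P(ℓ) ∈ 2E`» (the two directions (b)/(a)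
  of U-LEDGER §5 at prime level, now theorems about points instead of BSD-predictions);
* §3 the `4`-divisibility test DESCENDS to the `χ_ℓ`-part: `Y_χ ∈ 4E(K[ℓ]) ⟺ Y_χ = 4R` with `R` fixed by `T⁺` and negated by
  `T⁻` (`E(K[ℓ])[2] = 0`), i.e. the test lives in `E(K(√ℓ*))^{χ_ℓ} ≅ E^{(ℓ*)}(K)`.
READING (for the pen / planner-of-record): on the row-1 regime `M₀ ≥ 1` the open kernel U of crux 22136 AT PRIME LEVEL is
literally «some Kolyvagin prime `ℓ` at `2` has `ord₂`(divisibility of `Y_{χ_ℓ}` in the `χ_ℓ`-lattice) `= 1`» — W. Zhang's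
«Selmer-minimal ⟹ Heegner point indivisible» at `p = 2` for the genus twist `E^{(ℓ*)}/K`, shifted by the one forced factor `2`
of §1. Helper (`--supports stmt-BirchSwinnertonDyer-22136`); nothing here closes the crux; BSD is not proved by any of this.
-/

set_option linter.dupNamespace false -- tree convention: `Summit.BirchSwinnertonDyer.BirchSwinnertonDyer.Theorems` (summit = sub-problem)

noncomputable section

open scoped Classical

namespace Summit.BirchSwinnertonDyer.BirchSwinnertonDyer.Theorems.GenusKoly

open Finset NumberField WeierstrassCurve Literature.NumberTheory.EllipticCurves
  Literature.NumberTheory.EllipticCurves.ModularForms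

section Heegner

variable {W : WeierstrassCurve ℚ} [NeZero (W.conductorNorm ℤ)] {K : Type} [Field K] [NumberField K]
  {Dt : ModularParametrizationData W (W.conductorNorm ℤ)} {β : ℤ} {ι : K →+* ℂ}

omit [NeZero (W.conductorNorm ℤ)] in
/-- **`y₁` is unique**: two `K[n]`-points over the same complex point coincide (`E(K[n]) → E(ℂ)` is injective). [folklore] -/
theorem heegner_eq_of_map_eq {n : ℕ} {y₁ y₁' : (W.baseChange (ringClassField K ι n)).toAffine.Point}
    {z : (W.baseChange ℂ).toAffine.Point}
    (hy₁ : WeierstrassCurve.Affine.Point.map (W' := W) (ringClassField K ι n).subtype.toRatAlgHom y₁ = z)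
    (hy₁' : WeierstrassCurve.Affine.Point.map (W' := W) (ringClassField K ι n).subtype.toRatAlgHom y₁' = z) : y₁' = y₁ :=
  Affine.Point.map_injective (W' := W) (ringClassField K ι n).subtype.toRatAlgHom (hy₁'.trans hy₁.symm)

/-! ## §1 `Y_χ ∈ 2E(K[ℓ])` unconditionally at a Kolyvagin prime at `2` -/

/-- **The genus-character point is `2`-divisible at a Kolyvagin prime at `2`**: with `2 ∣ a_ℓ`,
`Y_χ = 2·Y⁺ − a_ℓ·y_K′ = 2·(Y⁺ − (a_ℓ/2)·y_K′) ∈ 2E(K[ℓ])`. So the genus Heegner index at `ℓ` is always even; what the crux's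
certificate asks (§2) is that it be EXACTLY one power of `2` deep. [cite: GrossLMS1991, §3 (3.5), Prop. 3.7 (1), §4 (4.1)] -/
theorem heegner_genusCharacterPoint_two_dvd [W.IsElliptic] [W.IsGloballyMinimal] (hK : IsImaginaryQuadratic K)
    (hD : NumberField.discr K < -4) (hH : SatisfiesHeegnerHypothesis (W.conductorNorm ℤ) K) {ℓ : ℕ} (hℓ : ℓ.Prime)
    (hinert : (Ideal.span {(ℓ : 𝓞 K)}).IsPrime) (hℓN : ¬ ℓ ∣ W.conductorNorm ℤ) (ha : (2 : ℤ) ∣ W.frobeniusTrace ℓ)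
    (d : KolyvaginHeegnerData Dt β ι ℓ)
    {θ : ringClassField K ι ℓ} {q : ℚ} (hθ2 : θ ^ 2 = algebraMap ℚ (ringClassField K ι ℓ) q) (hθ0 : θ ≠ 0)
    (Tp Tm : Finset (ringClassField K ι ℓ ≃ₐ[ℚ] ringClassField K ι ℓ))
    (hTp : ∀ g, g ∈ Tp ↔ g ∈ ringClassGal ι ℓ ∧ g θ = θ) (hTm : ∀ g, g ∈ Tm ↔ g ∈ ringClassGal ι ℓ ∧ g θ = -θ) :
    ∃ G : (W.baseChange (ringClassField K ι ℓ)).toAffine.Point, (2 : ℤ) • G =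
      ∑ g ∈ Tp, pointGalHom W (ringClassField K ι ℓ) g d.y - ∑ g ∈ Tm, pointGalHom W (ringClassField K ι ℓ) g d.y := by
  obtain ⟨y₁, -, h2⟩ := heegner_two_zsmul_fixPart_eq hK hD hH hℓ hinert hℓN d hθ2 hθ0 Tp Tm hTp hTm
  obtain ⟨a, ha⟩ := ha
  refine ⟨∑ g ∈ Tp, pointGalHom W (ringClassField K ι ℓ) g d.y -
    a • ∑ s ∈ d.S, pointGalHom W (ringClassField K ι ℓ) s y₁, ?_⟩
  rw [smul_sub, h2, ha, smul_smul]
  abel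

/-! ## §2 On `M₀ ≥ 1`: `P(ℓ) ∈ 2E(K[ℓ]) ⟺ Y_χ ∈ 4E(K[ℓ])`; the exactness criterion -/

/-- **`P(ℓ) ∈ 2E(K[ℓ]) ⟺ Y_χ ∈ 4E(K[ℓ])` when `y_K′ ∈ 2E(K[ℓ])`** (McCallum's `M₀ ≥ 1`; more generally whenever
`a_ℓ·y_K′ ∈ 4E(K[ℓ])`): for `W` globally minimal with `ρ̄_{E,2}` onto, `K` imaginary quadratic with odd `d_K < −4` and the
Heegner hypothesis, `ℓ ∤ N_E` a prime inert in `K` with `2 ∣ a_ℓ`, a datum `d` of conductor `ℓ`, `θ ∈ K[ℓ]` with `θ² ∈ ℚ`,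
`θ ≠ 0` moved by some element of `G_ℓ`, `T^±` the elements of `𝒢_ℓ` fixing/negating `θ`, and `y₁ ∈ E(K[ℓ])` over `x(1)` with
`Σ_{s∈S} s·y₁ ∈ 2E(K[ℓ])`. (`P(ℓ) ∈ 2E ⟺ Y⁺ ∈ 2E`, `2Y⁺ = a_ℓ y_K′ + Y_χ`, `E(K[ℓ])[2] = 0`.)
[cite: GrossLMS1991, §3 (3.5), Prop. 3.7 (1), §4 (4.1), Lemma 4.3] [cite: McCallumLMS1991, §5 (M₀)] -/
theorem heegner_exists_two_zsmul_eq_derivedPoint_iff_genusCharacterPoint_four_dvd [W.IsElliptic] [W.IsGloballyMinimal]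
    (hK : IsImaginaryQuadratic K) (hodd : Odd (NumberField.discr K)) (hD : NumberField.discr K < -4)
    (hH : SatisfiesHeegnerHypothesis (W.conductorNorm ℤ) K) (hsurj : W.HasSurjectiveModNGaloisRep ((2 : ℤ) ^ 1))
    {ℓ : ℕ} (hℓ : ℓ.Prime) (hinert : (Ideal.span {(ℓ : 𝓞 K)}).IsPrime) (hℓN : ¬ ℓ ∣ W.conductorNorm ℤ)
    (ha : (2 : ℤ) ∣ W.frobeniusTrace ℓ) (d : KolyvaginHeegnerData Dt β ι ℓ)
    {θ : ringClassField K ι ℓ} {q : ℚ} (hθ2 : θ ^ 2 = algebraMap ℚ (ringClassField K ι ℓ) q) (hθ0 : θ ≠ 0)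
    (hflip : ∃ τ ∈ ringClassGalOver ι ℓ 1, τ θ = -θ)
    (Tp Tm : Finset (ringClassField K ι ℓ ≃ₐ[ℚ] ringClassField K ι ℓ))
    (hTp : ∀ g, g ∈ Tp ↔ g ∈ ringClassGal ι ℓ ∧ g θ = θ) (hTm : ∀ g, g ∈ Tm ↔ g ∈ ringClassGal ι ℓ ∧ g θ = -θ)
    {y₁ : (W.baseChange (ringClassField K ι ℓ)).toAffine.Point}
    (hy₁ : WeierstrassCurve.Affine.Point.map (W' := W) (ringClassField K ι ℓ).subtype.toRatAlgHom y₁ =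
      heegnerPointComplexOfConductor Dt (NumberField.discr K) β 1)
    (hM : ∃ Q : (W.baseChange (ringClassField K ι ℓ)).toAffine.Point, (2 : ℤ) • Q =
      ∑ s ∈ d.S, pointGalHom W (ringClassField K ι ℓ) s y₁) :
    (∃ Q : (W.baseChange (ringClassField K ι ℓ)).toAffine.Point, (2 : ℤ) • Q = d.derivedPoint) ↔
      ∃ R : (W.baseChange (ringClassField K ι ℓ)).toAffine.Point, (4 : ℤ) • R =
        ∑ g ∈ Tp, pointGalHom W (ringClassField K ι ℓ) g d.y - ∑ g ∈ Tm, pointGalHom W (ringClassField K ι ℓ) g d.y := by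
  rw [heegner_exists_two_zsmul_eq_derivedPoint_iff_genusTrace hK hD hH hℓ hinert hℓN ha d hθ2 hθ0 hflip Tp hTp]
  obtain ⟨y₁', hy₁', h2⟩ := heegner_two_zsmul_fixPart_eq hK hD hH hℓ hinert hℓN d hθ2 hθ0 Tp Tm hTp hTm
  obtain rfl : y₁' = y₁ := heegner_eq_of_map_eq hy₁ hy₁'
  obtain ⟨a, ha2⟩ := ha
  obtain ⟨Q₀, hQ₀⟩ := hM
  have htors := heegner_two_torsion_free (ι := ι) hK hodd hH hsurj hℓ.ne_zero
  -- `2·Y⁺ = 4·(a•Q₀) + Y_χ`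
  have h2' : (2 : ℤ) • ∑ g ∈ Tp, pointGalHom W (ringClassField K ι ℓ) g d.y =
      (4 : ℤ) • (a • Q₀) + (∑ g ∈ Tp, pointGalHom W (ringClassField K ι ℓ) g d.y -
        ∑ g ∈ Tm, pointGalHom W (ringClassField K ι ℓ) g d.y) := by
    rw [h2, ha2, ← hQ₀]
    simp only [smul_smul]
    rw [show (2 * a) * 2 = (4 : ℤ) * a by ring]
  constructor
  · rintro ⟨Q, hQ⟩
    refine ⟨Q - a • Q₀, ?_⟩
    have : (4 : ℤ) • Q = (2 : ℤ) • ((2 : ℤ) • Q) := by rw [smul_smul]; norm_num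
    rw [smul_sub, this, hQ, h2']
    abel
  · rintro ⟨R, hR⟩
    refine ⟨a • Q₀ + R, ?_⟩
    have h0 : (2 : ℤ) • ((2 : ℤ) • (a • Q₀ + R) - ∑ g ∈ Tp, pointGalHom W (ringClassField K ι ℓ) g d.y) = 0 := by
      rw [smul_sub, h2', ← hR, smul_smul, smul_add, show ((2 : ℤ) * 2) = 4 by norm_num, sub_self]
    exact sub_eq_zero.mp (htors _ h0)

/-- **EXACTNESS CRITERION (positive direction).** Same frame, `y_K′ ∈ 2E(K[ℓ])` (`M₀ ≥ 1`): if the genus-character point is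
EXACTLY once `2`-divisible — `Y_χ = 2·G` with `G ∉ 2E(K[ℓ])` — then the Kolyvagin derived point `P(ℓ)` is `2`-primitive,
`P(ℓ) ∉ 2E(K[ℓ])`: the crux's certificate clause holds at `n = ℓ`. This is direction (b) of U-LEDGER §5 at prime level as a
theorem about points («exact `2`-adic Heegner index of the genus pair ⟹ certificate»). [cite: GrossLMS1991, §3 (3.5), §4 (4.1)]
[cite: McCallumLMS1991, §5] -/
theorem heegner_not_exists_two_zsmul_eq_derivedPoint_of_exact_genusCharacterPoint [W.IsElliptic] [W.IsGloballyMinimal]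
    (hK : IsImaginaryQuadratic K) (hodd : Odd (NumberField.discr K)) (hD : NumberField.discr K < -4)
    (hH : SatisfiesHeegnerHypothesis (W.conductorNorm ℤ) K) (hsurj : W.HasSurjectiveModNGaloisRep ((2 : ℤ) ^ 1))
    {ℓ : ℕ} (hℓ : ℓ.Prime) (hinert : (Ideal.span {(ℓ : 𝓞 K)}).IsPrime) (hℓN : ¬ ℓ ∣ W.conductorNorm ℤ)
    (ha : (2 : ℤ) ∣ W.frobeniusTrace ℓ) (d : KolyvaginHeegnerData Dt β ι ℓ)
    {θ : ringClassField K ι ℓ} {q : ℚ} (hθ2 : θ ^ 2 = algebraMap ℚ (ringClassField K ι ℓ) q) (hθ0 : θ ≠ 0)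
    (hflip : ∃ τ ∈ ringClassGalOver ι ℓ 1, τ θ = -θ)
    (Tp Tm : Finset (ringClassField K ι ℓ ≃ₐ[ℚ] ringClassField K ι ℓ))
    (hTp : ∀ g, g ∈ Tp ↔ g ∈ ringClassGal ι ℓ ∧ g θ = θ) (hTm : ∀ g, g ∈ Tm ↔ g ∈ ringClassGal ι ℓ ∧ g θ = -θ)
    {y₁ : (W.baseChange (ringClassField K ι ℓ)).toAffine.Point}
    (hy₁ : WeierstrassCurve.Affine.Point.map (W' := W) (ringClassField K ι ℓ).subtype.toRatAlgHom y₁ =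
      heegnerPointComplexOfConductor Dt (NumberField.discr K) β 1)
    (hM : ∃ Q : (W.baseChange (ringClassField K ι ℓ)).toAffine.Point, (2 : ℤ) • Q =
      ∑ s ∈ d.S, pointGalHom W (ringClassField K ι ℓ) s y₁)
    {G : (W.baseChange (ringClassField K ι ℓ)).toAffine.Point}
    (hG : (2 : ℤ) • G =
      ∑ g ∈ Tp, pointGalHom W (ringClassField K ι ℓ) g d.y - ∑ g ∈ Tm, pointGalHom W (ringClassField K ι ℓ) g d.y)
    (hGexact : ¬ ∃ Q : (W.baseChange (ringClassField K ι ℓ)).toAffine.Point, (2 : ℤ) • Q = G) :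
    ¬ ∃ Q : (W.baseChange (ringClassField K ι ℓ)).toAffine.Point, (2 : ℤ) • Q = d.derivedPoint := by
  rw [heegner_exists_two_zsmul_eq_derivedPoint_iff_genusCharacterPoint_four_dvd hK hodd hD hH hsurj hℓ hinert hℓN ha d
    hθ2 hθ0 hflip Tp Tm hTp hTm hy₁ hM]
  rintro ⟨R, hR⟩
  have htors := heegner_two_torsion_free (ι := ι) hK hodd hH hsurj hℓ.ne_zero
  refine hGexact ⟨R, ?_⟩
  have h0 : (2 : ℤ) • ((2 : ℤ) • R - G) = 0 := by
    rw [smul_sub, smul_smul, hG, show ((2 : ℤ) * 2) = 4 by norm_num, hR, sub_self]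
  exact sub_eq_zero.mp (htors _ h0)

/-- **EXACTNESS CRITERION (negative direction).** Same frame, `y_K′ ∈ 2E(K[ℓ])`: if `Y_χ ∈ 4E(K[ℓ])` (the genus Heegner index
at `ℓ` is at least two powers of `2` deep — BSD-predicted whenever `c_ℓ(E^{(ℓ*)}) = 4`, i.e. `Frob_ℓ = 1` on `E[2]`, or the genus
pair carries `2`-torsion in Ш: U-LEDGER (R1)), then `P(ℓ) ∈ 2E(K[ℓ])`: the prime `ℓ` certifies nothing.
[cite: GrossLMS1991, §3 (3.5), §4 (4.1)] [cite: McCallumLMS1991, §5] -/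
theorem heegner_exists_two_zsmul_eq_derivedPoint_of_genusCharacterPoint_four_dvd [W.IsElliptic] [W.IsGloballyMinimal]
    (hK : IsImaginaryQuadratic K) (hodd : Odd (NumberField.discr K)) (hD : NumberField.discr K < -4)
    (hH : SatisfiesHeegnerHypothesis (W.conductorNorm ℤ) K) (hsurj : W.HasSurjectiveModNGaloisRep ((2 : ℤ) ^ 1))
    {ℓ : ℕ} (hℓ : ℓ.Prime) (hinert : (Ideal.span {(ℓ : 𝓞 K)}).IsPrime) (hℓN : ¬ ℓ ∣ W.conductorNorm ℤ)
    (ha : (2 : ℤ) ∣ W.frobeniusTrace ℓ) (d : KolyvaginHeegnerData Dt β ι ℓ)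
    {θ : ringClassField K ι ℓ} {q : ℚ} (hθ2 : θ ^ 2 = algebraMap ℚ (ringClassField K ι ℓ) q) (hθ0 : θ ≠ 0)
    (hflip : ∃ τ ∈ ringClassGalOver ι ℓ 1, τ θ = -θ)
    (Tp Tm : Finset (ringClassField K ι ℓ ≃ₐ[ℚ] ringClassField K ι ℓ))
    (hTp : ∀ g, g ∈ Tp ↔ g ∈ ringClassGal ι ℓ ∧ g θ = θ) (hTm : ∀ g, g ∈ Tm ↔ g ∈ ringClassGal ι ℓ ∧ g θ = -θ)
    {y₁ : (W.baseChange (ringClassField K ι ℓ)).toAffine.Point}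
    (hy₁ : WeierstrassCurve.Affine.Point.map (W' := W) (ringClassField K ι ℓ).subtype.toRatAlgHom y₁ =
      heegnerPointComplexOfConductor Dt (NumberField.discr K) β 1)
    (hM : ∃ Q : (W.baseChange (ringClassField K ι ℓ)).toAffine.Point, (2 : ℤ) • Q =
      ∑ s ∈ d.S, pointGalHom W (ringClassField K ι ℓ) s y₁)
    (h4 : ∃ R : (W.baseChange (ringClassField K ι ℓ)).toAffine.Point, (4 : ℤ) • R =
      ∑ g ∈ Tp, pointGalHom W (ringClassField K ι ℓ) g d.y - ∑ g ∈ Tm, pointGalHom W (ringClassField K ι ℓ) g d.y) :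
    ∃ Q : (W.baseChange (ringClassField K ι ℓ)).toAffine.Point, (2 : ℤ) • Q = d.derivedPoint :=
  (heegner_exists_two_zsmul_eq_derivedPoint_iff_genusCharacterPoint_four_dvd hK hodd hD hH hsurj hℓ hinert hℓN ha d
    hθ2 hθ0 hflip Tp Tm hTp hTm hy₁ hM).mpr h4

/-! ## §3 The `4`-divisibility test descends to the `χ_ℓ`-part -/

/-- **`Y_χ ∈ 4E(K[ℓ]) ⟺ Y_χ = 4R` with `R` `χ_ℓ`-isotypic** (`R` fixed by `T⁺ = Gal(K[ℓ]/K(√ℓ*))`, negated by `T⁻`): a fourth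
root of the isotypic point `Y_χ` is itself isotypic, because `4(gR ∓ R) = gY_χ ∓ Y_χ = 0` and `E(K[ℓ])[2] = 0`. So the test of
§2 is a statement inside `E(K(√ℓ*))^{χ_ℓ}` — the Mordell–Weil lattice of the twist `E^{(ℓ*)}` over `K` — about its Heegner point.
[cite: GrossLMS1991, §4, Lemma 4.3] [cite: SilvermanAEC2009, X.2 Prop. 2.4 (proof)] -/
theorem heegner_genusCharacterPoint_four_dvd_iff_isotypic [W.IsElliptic] [W.IsGloballyMinimal]
    (hK : IsImaginaryQuadratic K) (hodd : Odd (NumberField.discr K))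
    (hH : SatisfiesHeegnerHypothesis (W.conductorNorm ℤ) K) (hsurj : W.HasSurjectiveModNGaloisRep ((2 : ℤ) ^ 1))
    {ℓ : ℕ} (hℓ : ℓ.Prime) (d : KolyvaginHeegnerData Dt β ι ℓ) {θ : ringClassField K ι ℓ}
    (Tp Tm : Finset (ringClassField K ι ℓ ≃ₐ[ℚ] ringClassField K ι ℓ))
    (hTp : ∀ g, g ∈ Tp ↔ g ∈ ringClassGal ι ℓ ∧ g θ = θ) (hTm : ∀ g, g ∈ Tm ↔ g ∈ ringClassGal ι ℓ ∧ g θ = -θ) :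
    (∃ R : (W.baseChange (ringClassField K ι ℓ)).toAffine.Point, (4 : ℤ) • R =
      ∑ g ∈ Tp, pointGalHom W (ringClassField K ι ℓ) g d.y - ∑ g ∈ Tm, pointGalHom W (ringClassField K ι ℓ) g d.y) ↔
    ∃ R : (W.baseChange (ringClassField K ι ℓ)).toAffine.Point, (4 : ℤ) • R =
      ∑ g ∈ Tp, pointGalHom W (ringClassField K ι ℓ) g d.y - ∑ g ∈ Tm, pointGalHom W (ringClassField K ι ℓ) g d.y ∧
      (∀ g ∈ Tp, pointGalHom W (ringClassField K ι ℓ) g R = R) ∧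
      (∀ g ∈ Tm, pointGalHom W (ringClassField K ι ℓ) g R = -R) := by
  refine ⟨?_, fun ⟨R, hR, _, _⟩ ↦ ⟨R, hR⟩⟩
  rintro ⟨R, hR⟩
  have htors := heegner_two_torsion_free (ι := ι) hK hodd hH hsurj hℓ.ne_zero
  -- `E(K[ℓ])[4] = 0` from `E(K[ℓ])[2] = 0`
  have htors4 : ∀ Q : (W.baseChange (ringClassField K ι ℓ)).toAffine.Point, (4 : ℤ) • Q = 0 → Q = 0 := fun Q hQ ↦ by
    have h2 : (2 : ℤ) • ((2 : ℤ) • Q) = 0 := by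
      rw [smul_smul, show ((2 : ℤ) * 2) = 4 by norm_num]
      exact hQ
    exact htors Q (htors _ h2)
  refine ⟨R, hR, fun g hg ↦ ?_, fun g hg ↦ ?_⟩
  · have hiso := (heegner_genusCharacterPoint_isotypic d Tp Tm hTp hTm ((hTp g).mp hg).1).1 ((hTp g).mp hg).2
    have h0 : (4 : ℤ) • (pointGalHom W (ringClassField K ι ℓ) g R - R) = 0 := by
      rw [smul_sub, ← map_zsmul, hR, hiso, sub_self]
    exact sub_eq_zero.mp (htors4 _ h0)
  · have hiso := (heegner_genusCharacterPoint_isotypic d Tp Tm hTp hTm ((hTm g).mp hg).1).2 ((hTm g).mp hg).2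
    have h0 : (4 : ℤ) • (pointGalHom W (ringClassField K ι ℓ) g R + R) = 0 := by
      rw [smul_add, ← map_zsmul, hR, hiso, neg_add_cancel]
    exact eq_neg_of_add_eq_zero_left (htors4 _ h0)

end Heegner

end Summit.BirchSwinnertonDyer.BirchSwinnertonDyer.Theorems.GenusKoly

end
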